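import Literature.NumberTheory.Automorphic.UnitaryGroupPureTensorContinuity
import Literature.NumberTheory.Automorphic.UnitaryGroupAdelicProductHaar
import HarnessLib

/-!
# Integrals of pure tensors on `U(H)(𝔸_{L⁺})`, I: the `∞ ⊔ f` split `∫ ⊗ f_v = κ · ∫ f_∞ · ∫ (⊗_{v∤∞} f_v)`

Topic `NumberTheory/Automorphic`; namespace `Literature.NumberTheory.Automorphic.UnitaryGroup.PureTensor`. THEOREMS
ONLY (no definition, no instance, no named fact, no `sorry`).

For a pure tensor `T = f_∞ ⊗ ⊗_v f_v` on the adelic unitary group `U(H)(𝔸_{L⁺})` (★ `UnitaryGroup.PureTensor`,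
`Rogawski1990/TestFunctions`) whose levels off the bad set `S` are the integral levels `U(H)(𝒪_v)` (★
`cmLocalIntegralLevel`, `LocalUnitaryIntegralLevel`), the evaluation `T.eval g` FACTORS through the decomposition
`U(H)(𝔸) = U(H)(L⁺ ⊗ ℝ) × U(H)(𝔸_{L⁺,f})` (★ `archPart`, `finPart`, `UnitaryGroupAdelicProduct`):

* `eval_eq_arch_mul_finFactor` — `T.eval g = f_∞(g_∞) · Λ_T(g_f)` with the FINITE-ADELIC FACTOR
  `Λ_T(b) = 1_{∀ v ∉ S, b_v ∈ U(H)(𝒪_v)} · ∏_{v ∈ S} f_v(b_v)` (written inline; `b_v = evalPlace v b` read in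
  `U(H)(L⁺_v)` through ★ `localPiEquiv`; ★ `localPiEquiv_evalPlace_finPart`, `toLocal_mem_localIntegralLevel_iff`);
* **`exists_integral_eval_eq_mul_integral_arch_mul_integral_finFactor`** — for Haar measures `ν` on `U(H)(𝔸)`, `μ_∞`
  on `U(H)(L⁺ ⊗ ℝ)`, `μ_f` on `U(H)(𝔸_f)` there is ONE `κ > 0` with
  `∫ T.eval dν = κ · (∫ f_∞ dμ_∞) · (∫ Λ_T dμ_f)` for EVERY such pure tensor (★
  `exists_integral_archPart_mul_finPart`; no integrability hypotheses — Bochner conventions);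
* `integrable_eval` — `T.eval` is integrable for every measure finite on compacts when `f_∞` and the `f_v`,
  `v ∈ S`, are continuous with compact support (★ `continuous_eval`, `hasCompactSupport_eval`).

The finite-adelic factor is then an Euler product `∫ Λ_T dμ_f = κ' · ∏_{v∈S} ∫ f_v dm_v` by the restricted-product
measure theory (`Literature/MeasureTheory/RestrictedProduct/ProductIntegral`, sequel file). Together:
`∫_{U(H)(𝔸)} ⊗ f_v = κ'' · ∫ f_∞ · ∏_{v ∈ S} ∫ f_v` — the factorisation every comparison of orbital integrals and
traces of pure tensors starts from (Borel–Jacquet (1979), §4.1; [Rogawski1990] §14.2).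

Written for the cell `pub/hodgecm-mathlib`, ENGINE T1 line `F0_T1InnerFormTraceIdentity` (brick B13). HC_CM is proved
only modulo the printed citations until rung 0 closes; this file is unconditional.

## References

* A. Borel, H. Jacquet, *Automorphic forms and automorphic representations*, PSPM 33.1 (1979), §4.1 [BorelJacquet1979].
* J. Rogawski, *Automorphic Representations of Unitary Groups in Three Variables*, Ann. of Math. Stud. 123 (1990),
  §14.2 p. 233 [Rogawski1990].
-/

noncomputable section

open MeasureTheory NumberField IsDedekindDomain Set
open scoped NNReal

namespace Literature.NumberTheory.Automorphic.UnitaryGroup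

section CM

variable {L : Type} [Field L] [NumberField L] [IsCMField L] {N : ℕ} {H : Matrix (Fin N) (Fin N) L}

namespace PureTensor

/-- **`T.eval g = f_∞(g_∞) · Λ_T(g_f)`**: a pure tensor with integral levels off `S` is the product of its
archimedean factor at `g_∞ = archPart g` and of its FINITE-ADELIC FACTOR
`Λ_T(b) = 1_{∀ v ∉ S, b_v ∈ U(H)(𝒪_v)} · ∏_{v∈S} f_v(b_v)` at `b = finPart g`. [cite: BorelJacquet1979, §4.1] -/
theorem eval_eq_arch_mul_finFactor (T : PureTensor L N H)
    (hK : ∀ v ∉ T.S, T.K v = cmLocalIntegralLevel L N H v) (g : (cmDatum L N H).Adelic) :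
    T.eval g =
      T.arch (archPart (↥(maximalRealSubfield L)) L (IsCMField.complexConj L) N H g) *
        ({b : finAdelic (↥(maximalRealSubfield L)) L (IsCMField.complexConj L) N H |
            ∀ v ∉ T.S, evalPlace (↥(maximalRealSubfield L)) L (IsCMField.complexConj L) N H v b ∈
              localInt L (IsCMField.complexConj L) N H v}.indicator
          (fun b => ∏ v ∈ T.S, T.loc v (localPiEquiv L (IsCMField.complexConj L) N H v
            (evalPlace (↥(maximalRealSubfield L)) L (IsCMField.complexConj L) N H v b)))
          (finPart (↥(maximalRealSubfield L)) L (IsCMField.complexConj L) N H g)) := by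
  classical
  -- the local components of `g` are those of its finite part
  have hloc : ∀ v, localPiEquiv L (IsCMField.complexConj L) N H v
      (evalPlace (↥(maximalRealSubfield L)) L (IsCMField.complexConj L) N H v
        (finPart (↥(maximalRealSubfield L)) L (IsCMField.complexConj L) N H g)) = (cmDatum L N H).toLocal v g :=
    fun v => localPiEquiv_evalPlace_finPart (↥(maximalRealSubfield L)) L (IsCMField.complexConj L) N H v g
  -- the unramified condition read on the finite part
  have hiff : (∀ v ∉ T.S, (cmDatum L N H).toLocal v g ∈ T.K v) ↔
      ∀ v ∉ T.S, evalPlace (↥(maximalRealSubfield L)) L (IsCMField.complexConj L) N H v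
        (finPart (↥(maximalRealSubfield L)) L (IsCMField.complexConj L) N H g) ∈
          localInt L (IsCMField.complexConj L) N H v := by
    refine forall₂_congr fun v hv => ?_
    rw [hK v hv, ← hloc v]
    exact localPiEquiv_mem_localIntegralLevel_iff (IsCMField.complexConj L) N H v _
  by_cases h : ∀ v ∉ T.S, (cmDatum L N H).toLocal v g ∈ T.K v
  · have hmem : finPart (↥(maximalRealSubfield L)) L (IsCMField.complexConj L) N H g ∈
        {b : finAdelic (↥(maximalRealSubfield L)) L (IsCMField.complexConj L) N H |
          ∀ v ∉ T.S, evalPlace (↥(maximalRealSubfield L)) L (IsCMField.complexConj L) N H v b ∈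
            localInt L (IsCMField.complexConj L) N H v} := hiff.1 h
    rw [eval_eq_of_forall_mem T g h, Set.indicator_of_mem hmem]
    simp_rw [hloc]
  · have hmem : finPart (↥(maximalRealSubfield L)) L (IsCMField.complexConj L) N H g ∉
        {b : finAdelic (↥(maximalRealSubfield L)) L (IsCMField.complexConj L) N H |
          ∀ v ∉ T.S, evalPlace (↥(maximalRealSubfield L)) L (IsCMField.complexConj L) N H v b ∈
            localInt L (IsCMField.complexConj L) N H v} := fun h' => h (hiff.2 h')
    rw [Set.indicator_of_notMem hmem, mul_zero, eval, if_neg h]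

/-- **The `∞ ⊔ f` split of the integral of a pure tensor.** For Haar measures `ν` on `U(H)(𝔸_{L⁺})`, `μ_∞` on
`U(H)(L⁺ ⊗ ℝ)` and `μ_f` on `U(H)(𝔸_{L⁺,f})` there is one `κ > 0` such that for EVERY pure tensor `T` with integral
levels off its bad set, `∫ T.eval dν = κ · (∫ f_∞ dμ_∞) · (∫ Λ_T dμ_f)`, `Λ_T` the finite-adelic factor of
`eval_eq_arch_mul_finFactor` (★ `exists_integral_archPart_mul_finPart`; Bochner conventions, no integrability
hypotheses). [cite: BorelJacquet1979, §4.1] -/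
theorem exists_integral_eval_eq_mul_integral_arch_mul_integral_finFactor
    [MeasurableSpace (adelic (↥(maximalRealSubfield L)) L (IsCMField.complexConj L) N H)]
    [BorelSpace (adelic (↥(maximalRealSubfield L)) L (IsCMField.complexConj L) N H)]
    [MeasurableSpace (UnitaryGroup.arch (↥(maximalRealSubfield L)) L (IsCMField.complexConj L) N H)]
    [BorelSpace (UnitaryGroup.arch (↥(maximalRealSubfield L)) L (IsCMField.complexConj L) N H)]
    [MeasurableSpace (finAdelic (↥(maximalRealSubfield L)) L (IsCMField.complexConj L) N H)]
    [BorelSpace (finAdelic (↥(maximalRealSubfield L)) L (IsCMField.complexConj L) N H)]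
    (ν : Measure (adelic (↥(maximalRealSubfield L)) L (IsCMField.complexConj L) N H)) [ν.IsHaarMeasure]
    (μa : Measure (UnitaryGroup.arch (↥(maximalRealSubfield L)) L (IsCMField.complexConj L) N H)) [μa.IsHaarMeasure]
    (μf : Measure (finAdelic (↥(maximalRealSubfield L)) L (IsCMField.complexConj L) N H)) [μf.IsHaarMeasure] :
    ∃ κ : ℝ≥0, 0 < κ ∧ ∀ (T : PureTensor L N H), (∀ v ∉ T.S, T.K v = cmLocalIntegralLevel L N H v) →
      ∫ g, T.eval g ∂ν = ((κ : ℝ) : ℂ) * ((∫ a, T.arch a ∂μa) *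
        ∫ b, {b : finAdelic (↥(maximalRealSubfield L)) L (IsCMField.complexConj L) N H |
            ∀ v ∉ T.S, evalPlace (↥(maximalRealSubfield L)) L (IsCMField.complexConj L) N H v b ∈
              localInt L (IsCMField.complexConj L) N H v}.indicator
          (fun b => ∏ v ∈ T.S, T.loc v (localPiEquiv L (IsCMField.complexConj L) N H v
            (evalPlace (↥(maximalRealSubfield L)) L (IsCMField.complexConj L) N H v b))) b ∂μf) := by
  obtain ⟨κ, hκ, h⟩ := exists_integral_archPart_mul_finPart (↥(maximalRealSubfield L)) L
    (IsCMField.complexConj L) N H ν μa μf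
  refine ⟨κ, hκ, fun T hK => ?_⟩
  have h2 := h (𝕜 := ℂ) T.arch
    ({b : finAdelic (↥(maximalRealSubfield L)) L (IsCMField.complexConj L) N H |
        ∀ v ∉ T.S, evalPlace (↥(maximalRealSubfield L)) L (IsCMField.complexConj L) N H v b ∈
          localInt L (IsCMField.complexConj L) N H v}.indicator
      (fun b => ∏ v ∈ T.S, T.loc v (localPiEquiv L (IsCMField.complexConj L) N H v
        (evalPlace (↥(maximalRealSubfield L)) L (IsCMField.complexConj L) N H v b))))
  exact (integral_congr_ae (Filter.Eventually.of_forall fun g => eval_eq_arch_mul_finFactor T hK g)).trans h2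

/-- **A pure tensor with continuous compactly supported factors is integrable** for every measure finite on compact
sets (★ `continuous_eval`, `hasCompactSupport_eval`). [cite: BorelJacquet1979, §4.1] -/
theorem integrable_eval (T : PureTensor L N H) (hK : ∀ v ∉ T.S, T.K v = cmLocalIntegralLevel L N H v)
    (harch : Continuous T.arch) (harchc : HasCompactSupport T.arch)
    (hloc : ∀ v ∈ T.S, Continuous (T.loc v)) (hlocc : ∀ v ∈ T.S, HasCompactSupport (T.loc v))
    [MeasurableSpace (cmDatum L N H).Adelic] [OpensMeasurableSpace (cmDatum L N H).Adelic]
    (ν : Measure (cmDatum L N H).Adelic) [IsFiniteMeasureOnCompacts ν] : Integrable T.eval ν :=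
  (continuous_eval T hK harch hloc).integrable_of_hasCompactSupport (hasCompactSupport_eval T hK harchc hlocc)

end PureTensor

end CM

end Literature.NumberTheory.Automorphic.UnitaryGroup

end
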